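import Summits.ABC.StewartYu.PadicW80ParLB
import Summits.ABC.StewartYu.PadicW80ParEnvelope
import HarnessLib

/-!
# The `(log p)`-normalised parameter record `PadicW80ParL` — the envelope of `U`

Support file (theorems only), cell `abc-stewartyu` (p1, stub S5 of memo-03 §4): twin of `PadicW80ParEnvelope.lean`
(p2's text) on the `ℓ`-normalised record:
**`U ≤ 2·Mcl·Cw(m)·((∏ nVⱼ)·nV_θ)·(W + log 2V_max)·log(2V_max)`**, `Cw(m) = (2⁶⁹ m)ᵐ` (the landed envelope constant,
reused), i.e. `U ≤ 2·Mcl·Cw(m)·(∏Vⱼ)V_θ·(W + log 2V_max)·log(2V_max)/ℓ^{m}` with `m = d + 1` generators: in the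
`SymmBound C r` clothing of the landed Theorem A this is `r(m) = m` (given the floor `W ≥ log p` of the record),
and for the twist engine (`Mcl = (p−1)/2`) the conclusion
`ord_p Θ ≤ 2·Mcl·Cw(m)·∏(Vⱼ/log p)·(W + log 2V_max)·log(2V_max)/log p`. The only new step w.r.t. the landed proof
is `nG = G/ℓ ≤ m log(2¹⁷ m V_max) + 1 ≤ 2·m(17.1 + 1.45 log m)·log(2V_max)` (`ℓ ≥ 1`).
[cite: Waldschmidt1980, §3.1 (p. 264)] [cite: Yu1990, Theorem 2.1 and (2.30) (pp. 32, 36)]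
-/

noncomputable section

open Finset Real

namespace Summit.ABC.StewartYu

open Literature.NumberTheory.Transcendental
open PadicW80Par (cTp cSp cLp cLp' Ap mRp Cw Cw_succ)

namespace PadicW80ParL

variable {d : ℕ} (P : PadicW80ParL d)

/-- **`U ≤ (2⁶⁹ m)ᵐ · (∏Vⱼ)V_θ · (W + log(2V_max)) · log(2V_max)`**: the parameter `U` of the
`p`-adic machine against the shape of Theorem A (`W⋆ ≤ m(10 + log m)(W + log 2V_max)`,
`G ≤ m(17.1 + 1.45 log m) log(2V_max)`, `m^{2m+1}/m! ≤ eᵐ m^{m+1}`).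
[cite: Waldschmidt1980, §3.1 (p. 264)] [cite: Yu1990, Theorem 1] -/
theorem U_le_Cw :
    P.Uℓ ≤ 2 * P.Mcl * (2 ^ 69 * mRp d) ^ (d + 1) * ((∏ j, P.nV j) * P.nVθ) * (P.W + Real.log (2 * P.Vm)) *
      Real.log (2 * P.Vm) := by
  have hm := two_le_mR P; have hm0 := mR_pos P; have hW := P.hW; have hVθ := P.one_le_nVθ
  have hVf := P.one_le_Vmax; have hℓ1 := P.hℓ; have hℓ := P.ℓ_pos; have hMcl := P.hMcl
  have hV := P.one_le_prodnV
  set L := Real.log (2 * P.Vm) with hL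
  have hl2 := Real.log_two_gt_d9; have hl2' := Real.log_two_lt_d9
  have hL2 : Real.log 2 ≤ L := by rw [hL]; exact Real.log_le_log two_pos (by linarith)
  have hL0 : 0 < L := by linarith
  have hlogm : 0 ≤ Real.log (mRp d) := Real.log_nonneg (by linarith)
  have hlogm' : Real.log (mRp d) ≤ mRp d := (Real.log_le_sub_one_of_pos hm0).trans (by linarith)
  -- `W⋆ ≤ m (10 + log m) (W + L)`
  have hWs : P.Wstarℓ ≤ mRp d * (10 + Real.log (mRp d)) * (P.W + L) := by
    unfold Wstarℓ
    refine max_le ?_ ?_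
    · have h1 : (1 : ℝ) * 1 * P.W ≤ mRp d * (10 + Real.log (mRp d)) * (P.W + L) := by
        gcongr
        · linarith
        · linarith
        · linarith
      linarith
    · have e : Real.log (2 ^ 13 * mRp d * P.Vm) = 12 * Real.log 2 + Real.log (mRp d) + L := by
        rw [hL, Real.log_mul (by positivity) (by linarith), Real.log_mul (by positivity) hm0.ne',
          Real.log_mul two_ne_zero (by linarith), Real.log_pow]; push_cast; ring
      rw [e]
      have h2 : 12 * Real.log 2 + Real.log (mRp d) + L ≤ (10 + Real.log (mRp d)) * (P.W + L) := by
        nlinarith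
      calc mRp d * (12 * Real.log 2 + Real.log (mRp d) + L) ≤ mRp d * ((10 + Real.log (mRp d)) * (P.W + L)) :=
            mul_le_mul_of_nonneg_left h2 hm0.le
        _ = mRp d * (10 + Real.log (mRp d)) * (P.W + L) := by ring
  -- `nG = G/ℓ ≤ m log(2^17 m Vmax) + 1 ≤ 2 · m (17.1 + 1.45 log m) L`
  have hG : P.nGℓ ≤ 2 * (mRp d * (17.1 + 1.45 * Real.log (mRp d)) * L) := by
    have e : Real.log (2 ^ 17 * mRp d * P.Vm) = 16 * Real.log 2 + Real.log (mRp d) + L := by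
      rw [hL, Real.log_mul (by positivity) (by linarith), Real.log_mul (by positivity) hm0.ne',
        Real.log_mul two_ne_zero (by linarith), Real.log_pow]; push_cast; ring
    have h2 : 16 * Real.log 2 + Real.log (mRp d) + L ≤ (17.1 + 1.45 * Real.log (mRp d)) * L := by
      nlinarith
    have hmain : mRp d * Real.log (2 ^ 17 * mRp d * P.Vm) ≤ mRp d * (17.1 + 1.45 * Real.log (mRp d)) * L := by
      rw [e]
      calc mRp d * (16 * Real.log 2 + Real.log (mRp d) + L) ≤ mRp d * ((17.1 + 1.45 * Real.log (mRp d)) * L) :=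
            mul_le_mul_of_nonneg_left h2 hm0.le
        _ = _ := by ring
    have hone : (1 : ℝ) ≤ mRp d * (17.1 + 1.45 * Real.log (mRp d)) * L := by
      have : (1 : ℝ) ≤ 2 * 17.1 * Real.log 2 := by nlinarith
      calc (1 : ℝ) ≤ 2 * 17.1 * Real.log 2 := this
        _ = 2 * (17.1 + 1.45 * 0) * Real.log 2 := by ring
        _ ≤ mRp d * (17.1 + 1.45 * Real.log (mRp d)) * L := by gcongr
    -- `nG = (m log(...) + ℓ)/ℓ = m log(...)/ℓ + 1 ≤ m log(...) + 1`
    have hnG : P.nGℓ ≤ mRp d * Real.log (2 ^ 17 * mRp d * P.Vm) + 1 := by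
      unfold nGℓ Gℓ
      rw [div_le_iff₀ hℓ]
      have h11 := P.eleven_le_logG
      have h0 : 0 ≤ mRp d * Real.log (2 ^ 17 * mRp d * P.Vm) := by positivity
      nlinarith
    calc P.nGℓ ≤ mRp d * Real.log (2 ^ 17 * mRp d * P.Vm) + 1 := hnG
      _ ≤ mRp d * (17.1 + 1.45 * Real.log (mRp d)) * L + 1 := by gcongr
      _ ≤ mRp d * (17.1 + 1.45 * Real.log (mRp d)) * L + mRp d * (17.1 + 1.45 * Real.log (mRp d)) * L := by
          gcongr
      _ = 2 * (mRp d * (17.1 + 1.45 * Real.log (mRp d)) * L) := by ring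
  -- `m^{2m+1}/m! ≤ e^m m^{m+1}`
  have hfac : mRp d ^ (2 * d + 3) / (d + 1).factorial ≤ Real.exp 1 ^ (d + 1) * mRp d ^ (d + 2) := by
    have hfacpos : (0 : ℝ) < (d + 1).factorial := by exact_mod_cast Nat.factorial_pos _
    have hst := CW77.pow_self_le_exp_mul_factorial (d + 1)
    have em : ((d + 1 : ℕ) : ℝ) = mRp d := by unfold mRp; push_cast; ring
    rw [em] at hst
    rw [div_le_iff₀ hfacpos]
    calc mRp d ^ (2 * d + 3) = mRp d ^ (d + 2) * mRp d ^ (d + 1) := by rw [← pow_add]; ring_nf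
      _ ≤ mRp d ^ (d + 2) * (Real.exp 1 ^ (d + 1) * (d + 1).factorial) := mul_le_mul_of_nonneg_left hst (by positivity)
      _ = Real.exp 1 ^ (d + 1) * mRp d ^ (d + 2) * (d + 1).factorial := by ring
  -- the constants: `A^m e^m m^{m+1} · m (10 + log m) · m (17.1 + 1.45 log m) ≤ (2^69 m)^m`
  have hconst : Ap ^ (d + 1) * (Real.exp 1 ^ (d + 1) * mRp d ^ (d + 2)) * (mRp d * (10 + Real.log (mRp d))) *
      (mRp d * (17.1 + 1.45 * Real.log (mRp d))) ≤ (2 ^ 69 * mRp d) ^ (d + 1) := by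
    have h1 : (10 + Real.log (mRp d)) * (17.1 + 1.45 * Real.log (mRp d)) ≤ 204.1 * mRp d ^ 2 := by nlinarith
    have h2 : mRp d ^ 5 ≤ 120 * Real.exp (mRp d) := by
      have := Real.pow_div_factorial_le_exp (mRp d) hm0.le 5
      rw [show (Nat.factorial 5 : ℝ) = 120 by norm_num, div_le_iff₀ (by norm_num)] at this
      linarith
    have he : Real.exp 1 ^ (d + 1) = Real.exp (mRp d) := by rw [← Real.exp_nat_mul]; unfold mRp; push_cast; ring_nf
    have hexp1 := Real.exp_one_lt_d9
    have h3 : Ap ^ (d + 1) * (Real.exp 1 ^ (d + 1) * mRp d ^ (d + 2)) * (mRp d * (10 + Real.log (mRp d))) *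
        (mRp d * (17.1 + 1.45 * Real.log (mRp d))) ≤ 204.1 * 120 * (Ap ^ (d + 1) * Real.exp (mRp d) ^ 2 * mRp d ^ (d + 1)) := by
      have hA : (0 : ℝ) ≤ Ap ^ (d + 1) := by unfold Ap; positivity
      calc Ap ^ (d + 1) * (Real.exp 1 ^ (d + 1) * mRp d ^ (d + 2)) * (mRp d * (10 + Real.log (mRp d))) *
            (mRp d * (17.1 + 1.45 * Real.log (mRp d)))
          = Ap ^ (d + 1) * Real.exp (mRp d) * mRp d ^ (d + 1) * mRp d ^ 3 *
              ((10 + Real.log (mRp d)) * (17.1 + 1.45 * Real.log (mRp d))) := by rw [he]; ring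
        _ ≤ Ap ^ (d + 1) * Real.exp (mRp d) * mRp d ^ (d + 1) * mRp d ^ 3 * (204.1 * mRp d ^ 2) := by
            gcongr
        _ = 204.1 * (Ap ^ (d + 1) * Real.exp (mRp d) * mRp d ^ (d + 1)) * mRp d ^ 5 := by ring
        _ ≤ 204.1 * (Ap ^ (d + 1) * Real.exp (mRp d) * mRp d ^ (d + 1)) * (120 * Real.exp (mRp d)) := by
            gcongr
        _ = 204.1 * 120 * (Ap ^ (d + 1) * Real.exp (mRp d) ^ 2 * mRp d ^ (d + 1)) := by ring
    refine h3.trans ?_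
    have he2 : Real.exp (mRp d) ^ 2 = Real.exp 2 ^ (d + 1) := by
      rw [← Real.exp_nat_mul, ← Real.exp_nat_mul]; unfold mRp; push_cast; ring_nf
    have he74 : Real.exp 2 ≤ 7.4 := by
      have : Real.exp 2 = Real.exp 1 ^ 2 := by rw [← Real.exp_nat_mul]; norm_num
      rw [this]; nlinarith [Real.exp_pos 1]
    have h4 : (204.1 : ℝ) * 120 * Real.exp 2 ^ (d + 1) ≤ (2 ^ 19) ^ (d + 1) := by
      calc (204.1 : ℝ) * 120 * Real.exp 2 ^ (d + 1) ≤ (204.1 * 120) ^ (d + 1) * Real.exp 2 ^ (d + 1) := by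
            gcongr
            have : (1 : ℝ) ≤ 204.1 * 120 := by norm_num
            calc (204.1 : ℝ) * 120 = (204.1 * 120) ^ 1 := (pow_one _).symm
              _ ≤ (204.1 * 120) ^ (d + 1) := pow_le_pow_right₀ this (by omega)
        _ = (204.1 * 120 * Real.exp 2) ^ (d + 1) := by ring
        _ ≤ (2 ^ 19) ^ (d + 1) := by
            apply pow_le_pow_left₀ (by positivity)
            nlinarith
    unfold Ap
    calc 204.1 * 120 * (((2 : ℝ) ^ 50) ^ (d + 1) * Real.exp (mRp d) ^ 2 * mRp d ^ (d + 1))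
        = (204.1 * 120 * Real.exp 2 ^ (d + 1)) * (((2 : ℝ) ^ 50) ^ (d + 1) * mRp d ^ (d + 1)) := by rw [he2]; ring
      _ ≤ (2 ^ 19) ^ (d + 1) * (((2 : ℝ) ^ 50) ^ (d + 1) * mRp d ^ (d + 1)) := by gcongr
      _ = (2 ^ 69 * mRp d) ^ (d + 1) := by
          rw [mul_pow, ← mul_assoc, ← pow_mul, ← pow_mul, ← pow_add, ← pow_mul,
            show 19 * (d + 1) + 50 * (d + 1) = 69 * (d + 1) by ring]
  -- assemble: `U = Mcl · (Aᵐ F X W⋆ nG)` with `X = (∏nV) nV_θ`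
  unfold Uℓ
  set X : ℝ := (∏ j, P.nV j) * P.nVθ with hX
  have hVV : 0 ≤ X := by rw [hX]; exact le_trans zero_le_one P.one_le_prodnVVθ
  have hA : (0 : ℝ) ≤ Ap ^ (d + 1) := by unfold Ap; positivity
  have hG0 := P.nG_pos.le; have hWs0 : 0 ≤ P.Wstarℓ := by linarith [P.one_le_Wstar]
  have hF0 : 0 ≤ mRp d ^ (2 * d + 3) / ((d + 1).factorial : ℝ) := by positivity
  have step1 : Ap ^ (d + 1) * (mRp d ^ (2 * d + 3) / (d + 1).factorial) * X * P.Wstarℓ * P.nGℓ ≤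
      Ap ^ (d + 1) * (Real.exp 1 ^ (d + 1) * mRp d ^ (d + 2)) * X *
          (mRp d * (10 + Real.log (mRp d)) * (P.W + L)) * (2 * (mRp d * (17.1 + 1.45 * Real.log (mRp d)) * L)) := by
    have hc1 : 0 ≤ Ap ^ (d + 1) * (Real.exp 1 ^ (d + 1) * mRp d ^ (d + 2)) * X :=
      mul_nonneg (mul_nonneg hA (by positivity)) hVV
    have hc2 : 0 ≤ mRp d * (10 + Real.log (mRp d)) * (P.W + L) :=
      mul_nonneg (mul_nonneg hm0.le (by linarith)) (by linarith)
    refine mul_le_mul (mul_le_mul (mul_le_mul_of_nonneg_right (mul_le_mul_of_nonneg_left hfac hA) hVV) hWs hWs0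
      hc1) hG hG0 (mul_nonneg hc1 hc2)
  have e : Ap ^ (d + 1) * (Real.exp 1 ^ (d + 1) * mRp d ^ (d + 2)) * X *
      (mRp d * (10 + Real.log (mRp d)) * (P.W + L)) * (2 * (mRp d * (17.1 + 1.45 * Real.log (mRp d)) * L)) =
      2 * ((Ap ^ (d + 1) * (Real.exp 1 ^ (d + 1) * mRp d ^ (d + 2)) * (mRp d * (10 + Real.log (mRp d))) *
        (mRp d * (17.1 + 1.45 * Real.log (mRp d)))) * (X * (P.W + L) * L)) := by ring
  have h0 : 0 ≤ X * (P.W + L) * L := by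
    have : 0 ≤ P.W + L := by linarith
    positivity
  have step2 : Ap ^ (d + 1) * (mRp d ^ (2 * d + 3) / (d + 1).factorial) * X * P.Wstarℓ * P.nGℓ ≤
      2 * ((2 ^ 69 * mRp d) ^ (d + 1) * (X * (P.W + L) * L)) := by
    refine step1.trans ?_
    rw [e]
    exact mul_le_mul_of_nonneg_left (mul_le_mul_of_nonneg_right hconst h0) (by norm_num)
  have hM0 : 0 ≤ P.Mcl := le_trans zero_le_one hMcl
  calc P.Mcl * Ap ^ (d + 1) * (mRp d ^ (2 * d + 3) / ↑(d + 1).factorial) * X * P.Wstarℓ * P.nGℓ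
      = P.Mcl * (Ap ^ (d + 1) * (mRp d ^ (2 * d + 3) / ↑(d + 1).factorial) * X * P.Wstarℓ * P.nGℓ) := by ring
    _ ≤ P.Mcl * (2 * ((2 ^ 69 * mRp d) ^ (d + 1) * (X * (P.W + L) * L))) := mul_le_mul_of_nonneg_left step2 hM0
    _ = 2 * P.Mcl * (2 ^ 69 * mRp d) ^ (d + 1) * X * (P.W + L) * L := by ring

/-- `U ≤ 2·Mcl·Cw(d+1) · ((∏nVⱼ)·nV_θ) · (W + log 2V_max) · log(2V_max)` with the landed envelope constant
`Cw m = (2⁶⁹ m)ᵐ`. [cite: Waldschmidt1980, §3.1 (p. 264)] [cite: Yu1990, Theorem 2.1] -/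
theorem U_le_Cw' :
    P.Uℓ ≤ 2 * P.Mcl * Cw (d + 1) * ((∏ j, P.nV j) * P.nVθ) * (P.W + Real.log (2 * P.Vm)) * Real.log (2 * P.Vm) := by
  rw [Cw_succ]; exact P.U_le_Cw

/-- `(∏ nVⱼ)·nV_θ = (∏Vⱼ)·V_θ / ℓ^{d+1}`: the normalisation in the clothing of the sizes. [cite: Yu1990, (2.30) (p. 36)] -/
theorem prodnV_eq : (∏ j, P.nV j) * P.nVθ = ((∏ j, P.V j) * P.Vθ) / P.ℓ ^ (d + 1) := by
  have hℓ := P.ℓ_pos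
  rw [eq_div_iff (by positivity), prod_congr rfl fun j _ => P.V_eq j, prod_mul_distrib, prod_const, card_univ,
    Fintype.card_fin, P.Vθ_eq]
  ring

/-- **The envelope in the sizes' clothing**: `U ≤ 2·Mcl·Cw(d+1)·(∏Vⱼ)V_θ·(W + log 2V_max)·log(2V_max)/ℓ^{d+1}`
(`r(m) = m` in the `SymmBound C r` shape of the landed Theorem A, under the record's floor `W ≥ ℓ`).
[cite: Waldschmidt1980, §3.1 (p. 264)] [cite: Yu1990, Theorem 2.1 and (2.30)] -/
theorem U_le_Cw_div :
    P.Uℓ ≤ 2 * P.Mcl * Cw (d + 1) * ((∏ j, P.V j) * P.Vθ) * (P.W + Real.log (2 * P.Vm)) * Real.log (2 * P.Vm) /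
      P.ℓ ^ (d + 1) := by
  have h := P.U_le_Cw'
  rw [P.prodnV_eq] at h
  have e : 2 * P.Mcl * Cw (d + 1) * ((∏ j, P.V j) * P.Vθ / P.ℓ ^ (d + 1)) * (P.W + Real.log (2 * P.Vm)) *
      Real.log (2 * P.Vm) = 2 * P.Mcl * Cw (d + 1) * ((∏ j, P.V j) * P.Vθ) * (P.W + Real.log (2 * P.Vm)) *
      Real.log (2 * P.Vm) / P.ℓ ^ (d + 1) := by ring
  rw [e] at h; exact h

/-- `V_θ ≤ U` (`∑V + V_θ ≤ 2⁻⁹⁰𝔘 ≤ U`). [cite: Waldschmidt1980, §3.1 (p. 264)] -/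
theorem Vel_le_U : P.Vθ ≤ P.Uℓ := by
  have h1 := P.sumV_le_𝔘
  have h2 := P.U_eq
  have hs : 0 ≤ ∑ j, P.V j := sum_nonneg fun j _ => le_trans zero_le_one (P.hV j)
  have h𝔘 := P.𝔘_pos
  have h3 : P.𝔘ℓ ≤ P.Uℓ := by
    rw [h2]
    have : (1 : ℝ) ≤ 2 ^ (d + 1) := one_le_pow₀ (by norm_num)
    nlinarith
  have h4 : P.Vθ ≤ 2 ^ 90 * ((∑ j, P.V j) + P.Vθ) := by
    have : (1 : ℝ) ≤ 2 ^ 90 := by norm_num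
    nlinarith [P.hVθ1]
  linarith

end PadicW80ParL

end Summit.ABC.StewartYu

end
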